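import Summits.QuantumFields.YangMills.Theorems.UnitScaleTiltProp7CornerCombFlatJensen
import HarnessLib

/-!
# `UnitScaleTiltProp7CornerCombFlatGradTransfer` — F-6b (flat half): the GRADIENT TRANSFER of the straight step with the SHARP constant
(`Σ_z ‖∇_ν S_{m+1}(z,κ)‖² ≤ L⁴·L⁻ᵈ·Σ_w ‖∇_ν S_m(w,κ)‖²`; in `d = 3` a factor `L` per step, `Lᵏ` for the tower — the B-slot growth of `hMcomb`)

«(O2) groundwork — not consumed by any displayed row before the freeze lifts» (★★OWNER ym3-torus-plan g29 RULINGS №19 (O2), №20 (2),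
№22 (c); «(II) GO» of record 2026-08-29T06:31:31Z; pen F-6b named by ★routeR-w1 g9 07:35:40Z «the sharp flat identity
`Σ_xΣ_s m_x(u − se_ν) = L²` first, dressing second»).  Companion of ✓II-2 `UnitScaleTiltProp7CornerCombFlatJensen` (same architecture, one more
telescoping): the coarse unit shift `z ↦ z + e_ν` of the straight average `Sm1 z κ = Σ_r L⁻ᵈ • asum Sm (L•z + r) (seg κ L)` is `L` fine unit
shifts, so (★`straight_step_fdiff_eq_sum`)
  `Sm1 (z + e_ν) κ − Sm1 z κ = Σ_{r∈[0,L)ᵈ} Σ_{t<L} Σ_{s<L} L⁻ᵈ • (Sm (w + e_ν) κ − Sm w κ)`,  `w = L•z + r + t•e_κ + s•e_ν`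
— `L^{d+2}` fine gradients of weight `L⁻ᵈ`.  Hence the POINTWISE JENSEN ★`straight_step_fdiffSq_le`
`‖∇_ν Sm1 (z,κ)‖² ≤ L²·L⁻ᵈ·Σ_{r,t,s}‖∇_ν Sm (w,κ)‖²`, the COLUMN COUNT ★`card_fiber2_le` (each fine site `w` is hit by at most `L²` of the
`(z; r, t, s)` — one `(z, r)` per `(t, s)`, lit ✓`blockMap_injective`; = «`Σ_xΣ_s m_x(u − se_ν) = L²`»), the summed step through a fold
★★`straight_step_sum_fdiffSq_le_fold` (period-cell socket, multiplicity hypothesis `≤ L²`) and on `ℤᵈ` ★★`straight_step_sum_fdiffSq_le`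
(`Σ_{z∈Zc}‖∇_νSm1(z,κ)‖² ≤ L⁴·L⁻ᵈ·Σ_{w∈Zf}‖∇_νSm(w,κ)‖²`, SHARP), and the tower ★★★`straight_tower_sum_fdiffSq_le`
(`Σ_{Z k}‖∇_ν S k‖² ≤ (L⁴L⁻ᵈ)ᵏ·Σ_{Z 0}‖∇_ν S 0‖²`; `gradWeight_pow_d3 : (L⁴(L³)⁻¹)ᵏ = Lᵏ`).  = MASTER 6efb31c3 §1 row 6 at the flat member
(«gradient transfer `L^{(4−d)∕2}`», ★routeR-w1's sharp identity), the flat twin of ✓`Prop7CovLineIterGrad.grad_recursion`; the covariant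
dressing (transported differences, ribbon holonomy `c₃L²p_j`) is F-6b-cov, typed against ★routeR-w6's F-6a letters.
Any `d`, any `L ≥ 1`, `𝔸` any normed ring + real normed space.  HONEST: elementary (telescoping + Jensen + counting); nothing of `hMcomb` ∕ `hMcomb₂`
∕ (β) ∕ `hD` ∕ the crux 19200 is proved or claimed; rung R3 (YM₃ on T³), not d = 4, not infinite volume, not a mass gap, not Clay.
-/

open scoped BigOperators
open Finset
open Literature.MathematicalPhysics.QuantumFieldTheory.Balaban1983to89.B7Prop1Explicit
open Literature.MathematicalPhysics.QuantumFieldTheory.Balaban1983to89.T4AveragingDeficitWallBoundary (blockMap_injective)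
open Summit.QuantumFields.YangMills.Theorems.Prop7CornerCombFlatJensen (straight_step_eq_sum)

namespace Summit.QuantumFields.YangMills.Theorems.Prop7CornerCombFlatGradTransfer

variable {d : ℕ} {𝔸 : Type*} [NormedRing 𝔸] [NormedSpace ℝ 𝔸]

/-! ## §1 The coarse unit shift of a straight average is `L` fine unit shifts -/

omit [NormedSpace ℝ 𝔸] in
/-- Telescoping a shift by `L•e_ν` into `L` unit shifts. [folklore] -/
theorem sub_shift_eq_sum_fdiff (f : Site d → 𝔸) (x : Site d) (ν : Fin d) (L : ℕ) :
    f (x + (L : ℤ) • e ν) - f x = ∑ s ∈ Finset.range L, (f (x + (s : ℤ) • e ν + e ν) - f (x + (s : ℤ) • e ν)) := by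
  have h := Finset.sum_range_sub (fun s : ℕ => f (x + (s : ℤ) • e ν)) L
  simp only [Nat.cast_zero, zero_smul, add_zero] at h
  rw [← h]
  refine Finset.sum_congr rfl fun s _ => ?_
  congr 2
  push_cast
  rw [add_smul, one_smul, add_assoc]

/-- ★ **THE COARSE GRADIENT OF A STRAIGHT STEP** is a sum of `L^{d+2}` fine gradients of weight `L⁻ᵈ`:
`Sm1 (z + e_ν) κ − Sm1 z κ = Σ_r Σ_{t<L} Σ_{s<L} L⁻ᵈ • (Sm (w + e_ν) κ − Sm w κ)`, `w = L•z + boxVec L r + t•e_κ + s•e_ν`.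
[folklore] [cite: Balaban1985Averaging, (125) p.36] -/
theorem straight_step_fdiff_eq_sum (L : ℕ) (Sm Sm1 : Site d → Fin d → 𝔸) (z : Site d) (κ ν : Fin d)
    (h : ∀ z' : Site d, Sm1 z' κ = ∑ r : Fin d → Fin L, (((L : ℝ) ^ d)⁻¹) • asum Sm ((L : ℤ) • z' + boxVec L r) (seg κ (L : ℤ))) :
    Sm1 (z + e ν) κ - Sm1 z κ = ∑ r : Fin d → Fin L, ∑ t ∈ Finset.range L, ∑ s ∈ Finset.range L,
      (((L : ℝ) ^ d)⁻¹) • (Sm ((L : ℤ) • z + boxVec L r + (t : ℤ) • e κ + (s : ℤ) • e ν + e ν) κ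
        - Sm ((L : ℤ) • z + boxVec L r + (t : ℤ) • e κ + (s : ℤ) • e ν) κ) := by
  rw [straight_step_eq_sum L Sm Sm1 (z + e ν) κ (h (z + e ν)), straight_step_eq_sum L Sm Sm1 z κ (h z), ← Finset.sum_sub_distrib]
  refine Finset.sum_congr rfl fun r _ => ?_
  rw [← Finset.sum_sub_distrib]
  refine Finset.sum_congr rfl fun t _ => ?_
  rw [← smul_sub, ← Finset.smul_sum]
  congr 1
  have hx : (L : ℤ) • (z + e ν) + boxVec L r + (t : ℤ) • e κ = ((L : ℤ) • z + boxVec L r + (t : ℤ) • e κ) + (L : ℤ) • e ν := by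
    rw [smul_add]; abel
  rw [hx]
  exact sub_shift_eq_sum_fdiff (fun x => Sm x κ) _ ν L

/-! ## §2 Pointwise Jensen for the coarse gradient -/

/-- ★ **POINTWISE JENSEN FOR THE GRADIENT**: `‖Sm1 (z+e_ν) κ − Sm1 z κ‖² ≤ L²·L⁻ᵈ·Σ_{r,t,s}‖Sm (w+e_ν) κ − Sm w κ‖²` (`L^{d+2}` terms of weight
`L⁻ᵈ`, weights summing to `L²`). [folklore] -/
theorem straight_step_fdiffSq_le (L : ℕ) (Sm Sm1 : Site d → Fin d → 𝔸) (z : Site d) (κ ν : Fin d)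
    (h : ∀ z' : Site d, Sm1 z' κ = ∑ r : Fin d → Fin L, (((L : ℝ) ^ d)⁻¹) • asum Sm ((L : ℤ) • z' + boxVec L r) (seg κ (L : ℤ))) :
    ‖Sm1 (z + e ν) κ - Sm1 z κ‖ ^ 2 ≤ (L : ℝ) ^ 2 * ((L : ℝ) ^ d)⁻¹ *
      ∑ r : Fin d → Fin L, ∑ t ∈ Finset.range L, ∑ s ∈ Finset.range L,
        ‖Sm ((L : ℤ) • z + boxVec L r + (t : ℤ) • e κ + (s : ℤ) • e ν + e ν) κ
          - Sm ((L : ℤ) • z + boxVec L r + (t : ℤ) • e κ + (s : ℤ) • e ν) κ‖ ^ 2 := by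
  set c : ℝ := ((L : ℝ) ^ d)⁻¹ with hc
  have hc0 : 0 ≤ c := by positivity
  set g : (Fin d → Fin L) × (ℕ × ℕ) → 𝔸 := fun p =>
    Sm ((L : ℤ) • z + boxVec L p.1 + (p.2.1 : ℤ) • e κ + (p.2.2 : ℤ) • e ν + e ν) κ
      - Sm ((L : ℤ) • z + boxVec L p.1 + (p.2.1 : ℤ) • e κ + (p.2.2 : ℤ) • e ν) κ with hg
  set I : Finset ((Fin d → Fin L) × (ℕ × ℕ)) :=
    (Finset.univ : Finset (Fin d → Fin L)) ×ˢ (Finset.range L ×ˢ Finset.range L) with hI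
  have hsum : Sm1 (z + e ν) κ - Sm1 z κ = ∑ p ∈ I, c • g p := by
    rw [straight_step_fdiff_eq_sum L Sm Sm1 z κ ν h, hI, Finset.sum_product]
    simp only [Finset.sum_product, hg, hc]
  have hsum2 : ∑ r : Fin d → Fin L, ∑ t ∈ Finset.range L, ∑ s ∈ Finset.range L,
        ‖Sm ((L : ℤ) • z + boxVec L r + (t : ℤ) • e κ + (s : ℤ) • e ν + e ν) κ
          - Sm ((L : ℤ) • z + boxVec L r + (t : ℤ) • e κ + (s : ℤ) • e ν) κ‖ ^ 2 = ∑ p ∈ I, ‖g p‖ ^ 2 := by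
    rw [hI, Finset.sum_product]
    simp only [Finset.sum_product, hg]
  have hcard : (#I : ℝ) = (L : ℝ) ^ d * L * L := by
    rw [hI, Finset.card_product, Finset.card_product, Finset.card_univ, Fintype.card_fun, Fintype.card_fin, Fintype.card_fin,
      Finset.card_range]
    push_cast; ring
  have h1 : ‖Sm1 (z + e ν) κ - Sm1 z κ‖ ≤ ∑ p ∈ I, c * ‖g p‖ := by
    rw [hsum]
    refine (norm_sum_le _ _).trans (Finset.sum_le_sum fun p _ => ?_)
    exact (norm_smul_le _ _).trans (by rw [Real.norm_of_nonneg hc0])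
  have h2 : ‖Sm1 (z + e ν) κ - Sm1 z κ‖ ^ 2 ≤ (∑ p ∈ I, c * ‖g p‖) ^ 2 := pow_le_pow_left₀ (norm_nonneg _) h1 2
  have h3 : (∑ p ∈ I, c * ‖g p‖) ^ 2 ≤ #I * ∑ p ∈ I, (c * ‖g p‖) ^ 2 := sq_sum_le_card_mul_sum_sq
  rw [hsum2]
  calc ‖Sm1 (z + e ν) κ - Sm1 z κ‖ ^ 2 ≤ #I * ∑ p ∈ I, (c * ‖g p‖) ^ 2 := h2.trans h3
    _ = (L : ℝ) ^ 2 * ((L : ℝ) ^ d)⁻¹ * ∑ p ∈ I, ‖g p‖ ^ 2 := by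
      rw [hcard]
      simp only [mul_pow, ← Finset.mul_sum, hc]
      have hLd : ((L : ℝ) ^ d) ≠ 0 ∨ L = 0 := by
        by_cases hL : L = 0
        · exact Or.inr hL
        · exact Or.inl (pow_ne_zero _ (by exact_mod_cast hL))
      rcases hLd with hLd | hL0
      · field_simp
      · subst hL0
        rcases Nat.eq_zero_or_pos d with hd | hd
        · subst hd; simp
        · simp [zero_pow hd.ne']

/-! ## §3 The column count: one `(z, r)` per `(t, s)` — multiplicity `L²` (the identity `Σ_xΣ_s m_x(u − se_ν) = L²`) -/

/-- ★ **Fibres have at most `L²` points**: among `(z; r, t, s)` with `t, s < L`, at most `L²` map to a given fine site under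
`(z, r, t, s) ↦ L•z + boxVec L r + t•e_κ + s•e_ν` (one `(z, r)` per `(t, s)`, lit ✓`blockMap_injective`). [folklore] -/
theorem card_fiber2_le (L : ℕ) (hL : 1 ≤ L) (κ ν : Fin d) (S : Finset (Site d × ((Fin d → Fin L) × (ℕ × ℕ))))
    (hS : ∀ p ∈ S, p.2.2.1 < L ∧ p.2.2.2 < L) (w : Site d) :
    #{p ∈ S | (L : ℤ) • p.1 + boxVec L p.2.1 + (p.2.2.1 : ℤ) • e κ + (p.2.2.2 : ℤ) • e ν = w} ≤ L ^ 2 := by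
  classical
  calc #{p ∈ S | (L : ℤ) • p.1 + boxVec L p.2.1 + (p.2.2.1 : ℤ) • e κ + (p.2.2.2 : ℤ) • e ν = w}
      ≤ #(Finset.range L ×ˢ Finset.range L) := by
        refine Finset.card_le_card_of_injOn (fun p => p.2.2) (fun p hp => ?_) (fun p hp p' hp' hts => ?_)
        · simp only [Finset.coe_filter, Set.mem_setOf_eq] at hp
          simp only [Finset.coe_product, Finset.coe_range, Set.mem_prod, Set.mem_Iio]
          exact hS p hp.1
        · simp only [Finset.coe_filter, Set.mem_setOf_eq] at hp hp'
          simp only at hts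
          have hzr : (L : ℤ) • p.1 + boxVec L p.2.1 = (L : ℤ) • p'.1 + boxVec L p'.2.1 := by
            have := hp.2.trans hp'.2.symm
            rw [hts] at this
            exact add_right_cancel (add_right_cancel this)
          have := blockMap_injective L hL (a₁ := (p.1, p.2.1)) (a₂ := (p'.1, p'.2.1)) hzr
          simp only [Prod.mk.injEq] at this
          exact Prod.ext this.1 (Prod.ext this.2 hts)
    _ = L ^ 2 := by rw [Finset.card_product, Finset.card_range]; ring

/-! ## §4 The summed gradient transfer -/

/-- ★★ **SUMMED GRADIENT TRANSFER THROUGH A FOLD** (period-cell form): classes `fold : Site d → ι`, `T i` dominating `‖∇_ν Sm (w,κ)‖²` on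
the class of `w`, each class `i ∈ Zf` hit by at most `L²` of the `(z; r, t, s) ∈ Zc × [0,L)ᵈ × [0,L)²`.  Then
`Σ_{z∈Zc}‖Sm1 (z+e_ν) κ − Sm1 z κ‖² ≤ L⁴·L⁻ᵈ·Σ_{i∈Zf} T i` — the SHARP one-step constant `L^{4−d}`. [folklore] -/
theorem straight_step_sum_fdiffSq_le_fold (L : ℕ) (Sm Sm1 : Site d → Fin d → 𝔸) (κ ν : Fin d)
    (h : ∀ z : Site d, Sm1 z κ = ∑ r : Fin d → Fin L, (((L : ℝ) ^ d)⁻¹) • asum Sm ((L : ℤ) • z + boxVec L r) (seg κ (L : ℤ)))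
    (Zc : Finset (Site d)) {ι : Type*} [DecidableEq ι] (fold : Site d → ι) (Zf : Finset ι) (T : ι → ℝ)
    (hT : ∀ z ∈ Zc, ∀ (r : Fin d → Fin L) (t s : ℕ), t < L → s < L →
      ‖Sm ((L : ℤ) • z + boxVec L r + (t : ℤ) • e κ + (s : ℤ) • e ν + e ν) κ
        - Sm ((L : ℤ) • z + boxVec L r + (t : ℤ) • e κ + (s : ℤ) • e ν) κ‖ ^ 2
        ≤ T (fold ((L : ℤ) • z + boxVec L r + (t : ℤ) • e κ + (s : ℤ) • e ν)))
    (hmaps : ∀ z ∈ Zc, ∀ (r : Fin d → Fin L) (t s : ℕ), t < L → s < L →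
      fold ((L : ℤ) • z + boxVec L r + (t : ℤ) • e κ + (s : ℤ) • e ν) ∈ Zf)
    (hT0 : ∀ i ∈ Zf, 0 ≤ T i)
    (hmult : ∀ i ∈ Zf, #{p ∈ Zc ×ˢ ((Finset.univ : Finset (Fin d → Fin L)) ×ˢ (Finset.range L ×ˢ Finset.range L)) |
        fold ((L : ℤ) • p.1 + boxVec L p.2.1 + (p.2.2.1 : ℤ) • e κ + (p.2.2.2 : ℤ) • e ν) = i} ≤ L ^ 2) :
    ∑ z ∈ Zc, ‖Sm1 (z + e ν) κ - Sm1 z κ‖ ^ 2 ≤ (L : ℝ) ^ 4 * ((L : ℝ) ^ d)⁻¹ * ∑ i ∈ Zf, T i := by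
  classical
  set P : Finset (Site d × ((Fin d → Fin L) × (ℕ × ℕ))) :=
    Zc ×ˢ ((Finset.univ : Finset (Fin d → Fin L)) ×ˢ (Finset.range L ×ˢ Finset.range L)) with hP
  set π : Site d × ((Fin d → Fin L) × (ℕ × ℕ)) → Site d :=
    fun p => (L : ℤ) • p.1 + boxVec L p.2.1 + (p.2.2.1 : ℤ) • e κ + (p.2.2.2 : ℤ) • e ν with hπ
  have hc0 : 0 ≤ (L : ℝ) ^ 2 * ((L : ℝ) ^ d)⁻¹ := by positivity
  have h1 : ∑ z ∈ Zc, ‖Sm1 (z + e ν) κ - Sm1 z κ‖ ^ 2 ≤ (L : ℝ) ^ 2 * ((L : ℝ) ^ d)⁻¹ * ∑ p ∈ P, T (fold (π p)) := by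
    calc ∑ z ∈ Zc, ‖Sm1 (z + e ν) κ - Sm1 z κ‖ ^ 2
        ≤ ∑ z ∈ Zc, (L : ℝ) ^ 2 * ((L : ℝ) ^ d)⁻¹ *
            ∑ r : Fin d → Fin L, ∑ t ∈ Finset.range L, ∑ s ∈ Finset.range L,
              ‖Sm ((L : ℤ) • z + boxVec L r + (t : ℤ) • e κ + (s : ℤ) • e ν + e ν) κ
                - Sm ((L : ℤ) • z + boxVec L r + (t : ℤ) • e κ + (s : ℤ) • e ν) κ‖ ^ 2 :=
          Finset.sum_le_sum fun z _ => straight_step_fdiffSq_le L Sm Sm1 z κ ν h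
      _ ≤ ∑ z ∈ Zc, (L : ℝ) ^ 2 * ((L : ℝ) ^ d)⁻¹ *
            ∑ r : Fin d → Fin L, ∑ t ∈ Finset.range L, ∑ s ∈ Finset.range L,
              T (fold ((L : ℤ) • z + boxVec L r + (t : ℤ) • e κ + (s : ℤ) • e ν)) := by
          refine Finset.sum_le_sum fun z hz => mul_le_mul_of_nonneg_left ?_ hc0
          exact Finset.sum_le_sum fun r _ => Finset.sum_le_sum fun t ht => Finset.sum_le_sum fun s hs =>
            hT z hz r t s (Finset.mem_range.mp ht) (Finset.mem_range.mp hs)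
      _ = (L : ℝ) ^ 2 * ((L : ℝ) ^ d)⁻¹ * ∑ p ∈ P, T (fold (π p)) := by
          rw [← Finset.mul_sum, hP, Finset.sum_product]
          simp only [Finset.sum_product, hπ]
  have h2 : ∑ p ∈ P, T (fold (π p)) ≤ (L : ℝ) ^ 2 * ∑ i ∈ Zf, T i := by
    rw [Finset.sum_comp (s := P) (f := T) (g := fun p => fold (π p))]
    have hsub : P.image (fun p => fold (π p)) ⊆ Zf := by
      intro i hi
      obtain ⟨p, hp, rfl⟩ := Finset.mem_image.mp hi
      rw [hP, Finset.mem_product, Finset.mem_product, Finset.mem_product] at hp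
      exact hmaps p.1 hp.1 p.2.1 p.2.2.1 p.2.2.2 (Finset.mem_range.mp hp.2.2.1) (Finset.mem_range.mp hp.2.2.2)
    calc ∑ i ∈ P.image (fun p => fold (π p)), (#{p ∈ P | fold (π p) = i}) • T i
        ≤ ∑ i ∈ P.image (fun p => fold (π p)), (L : ℝ) ^ 2 * T i := by
          refine Finset.sum_le_sum fun i hi => ?_
          rw [nsmul_eq_mul]
          exact mul_le_mul_of_nonneg_right (by exact_mod_cast hmult i (hsub hi)) (hT0 i (hsub hi))
      _ ≤ ∑ i ∈ Zf, (L : ℝ) ^ 2 * T i :=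
          Finset.sum_le_sum_of_subset_of_nonneg hsub fun i hi _ => mul_nonneg (by positivity) (hT0 i hi)
      _ = (L : ℝ) ^ 2 * ∑ i ∈ Zf, T i := by rw [Finset.mul_sum]
  calc ∑ z ∈ Zc, ‖Sm1 (z + e ν) κ - Sm1 z κ‖ ^ 2 ≤ (L : ℝ) ^ 2 * ((L : ℝ) ^ d)⁻¹ * ∑ p ∈ P, T (fold (π p)) := h1
    _ ≤ (L : ℝ) ^ 2 * ((L : ℝ) ^ d)⁻¹ * ((L : ℝ) ^ 2 * ∑ i ∈ Zf, T i) := mul_le_mul_of_nonneg_left h2 hc0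
    _ = (L : ℝ) ^ 4 * ((L : ℝ) ^ d)⁻¹ * ∑ i ∈ Zf, T i := by ring

/-- ★★ **SUMMED GRADIENT TRANSFER ON `ℤᵈ`** (fold = identity; multiplicity `≤ L²` automatic): for any finite `Zc` and any `Zf` containing every
`L•z + r + t•e_κ + s•e_ν` (`z ∈ Zc`, `r ∈ [0,L)ᵈ`, `t, s < L`): `Σ_{z∈Zc}‖Sm1 (z+e_ν) κ − Sm1 z κ‖² ≤ L⁴·L⁻ᵈ·Σ_{w∈Zf}‖Sm (w+e_ν) κ − Sm w κ‖²` —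
the sharp constant `L^{4−d}` (★routeR-w1 g9's `Σ_xΣ_s m_x(u − se_ν) = L²`). [folklore] [cite: Balaban1985Averaging, (125) p.36] -/
theorem straight_step_sum_fdiffSq_le (L : ℕ) (hL : 1 ≤ L) (Sm Sm1 : Site d → Fin d → 𝔸) (κ ν : Fin d)
    (h : ∀ z : Site d, Sm1 z κ = ∑ r : Fin d → Fin L, (((L : ℝ) ^ d)⁻¹) • asum Sm ((L : ℤ) • z + boxVec L r) (seg κ (L : ℤ)))
    (Zc Zf : Finset (Site d))
    (hZf : ∀ z ∈ Zc, ∀ (r : Fin d → Fin L) (t s : ℕ), t < L → s < L →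
      (L : ℤ) • z + boxVec L r + (t : ℤ) • e κ + (s : ℤ) • e ν ∈ Zf) :
    ∑ z ∈ Zc, ‖Sm1 (z + e ν) κ - Sm1 z κ‖ ^ 2
      ≤ (L : ℝ) ^ 4 * ((L : ℝ) ^ d)⁻¹ * ∑ w ∈ Zf, ‖Sm (w + e ν) κ - Sm w κ‖ ^ 2 := by
  classical
  refine straight_step_sum_fdiffSq_le_fold L Sm Sm1 κ ν h Zc id Zf (fun w => ‖Sm (w + e ν) κ - Sm w κ‖ ^ 2)
    (fun z _ r t s _ _ => le_rfl) hZf (fun i _ => by positivity) fun w _ => ?_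
  refine card_fiber2_le L hL κ ν _ (fun p hp => ?_) w
  rw [Finset.mem_product, Finset.mem_product, Finset.mem_product] at hp
  exact ⟨Finset.mem_range.mp hp.2.2.1, Finset.mem_range.mp hp.2.2.2⟩

/-! ## §5 The `k`-fold gradient transfer -/

/-- ★★★ **GRADIENT TRANSFER FOR THE STRAIGHT TOWER** along a chain of finite site sets absorbing the images:
`Σ_{z∈Z k}‖S k (z+e_ν) κ − S k z κ‖² ≤ (L⁴·L⁻ᵈ)ᵏ · Σ_{w∈Z 0}‖S 0 (w+e_ν) κ − S 0 w κ‖²` — in `d = 3` the factor is `Lᵏ`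
(★`gradWeight_pow_d3`): the B-slot growth of the split currency with constant exactly `1`. «(O2) groundwork — not consumed by any displayed
row before the freeze lifts.» [folklore] [cite: Balaban1985Averaging, (125) p.36, (43) p.24] -/
theorem straight_tower_sum_fdiffSq_le (L : ℕ) (hL : 1 ≤ L) (S : ℕ → Site d → Fin d → 𝔸) (κ ν : Fin d)
    (hS : ∀ (m : ℕ) (z : Site d),
      S (m + 1) z κ = ∑ r : Fin d → Fin L, (((L : ℝ) ^ d)⁻¹) • asum (S m) ((L : ℤ) • z + boxVec L r) (seg κ (L : ℤ)))
    (Z : ℕ → Finset (Site d))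
    (hZ : ∀ (m : ℕ), ∀ z ∈ Z (m + 1), ∀ (r : Fin d → Fin L) (t s : ℕ), t < L → s < L →
      (L : ℤ) • z + boxVec L r + (t : ℤ) • e κ + (s : ℤ) • e ν ∈ Z m)
    (k : ℕ) :
    ∑ z ∈ Z k, ‖S k (z + e ν) κ - S k z κ‖ ^ 2
      ≤ ((L : ℝ) ^ 4 * ((L : ℝ) ^ d)⁻¹) ^ k * ∑ w ∈ Z 0, ‖S 0 (w + e ν) κ - S 0 w κ‖ ^ 2 := by
  induction k with
  | zero => simp
  | succ k ih =>
    have hstep := straight_step_sum_fdiffSq_le L hL (S k) (S (k + 1)) κ ν (hS k) (Z (k + 1)) (Z k) (hZ k)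
    have hc0 : 0 ≤ (L : ℝ) ^ 4 * ((L : ℝ) ^ d)⁻¹ := by positivity
    calc ∑ z ∈ Z (k + 1), ‖S (k + 1) (z + e ν) κ - S (k + 1) z κ‖ ^ 2
        ≤ (L : ℝ) ^ 4 * ((L : ℝ) ^ d)⁻¹ * ∑ w ∈ Z k, ‖S k (w + e ν) κ - S k w κ‖ ^ 2 := hstep
      _ ≤ (L : ℝ) ^ 4 * ((L : ℝ) ^ d)⁻¹ *
            (((L : ℝ) ^ 4 * ((L : ℝ) ^ d)⁻¹) ^ k * ∑ w ∈ Z 0, ‖S 0 (w + e ν) κ - S 0 w κ‖ ^ 2) :=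
          mul_le_mul_of_nonneg_left ih hc0
      _ = ((L : ℝ) ^ 4 * ((L : ℝ) ^ d)⁻¹) ^ (k + 1) * ∑ w ∈ Z 0, ‖S 0 (w + e ν) κ - S 0 w κ‖ ^ 2 := by ring

/-- In three dimensions the `k`-fold gradient weight is `Lᵏ`: `(L⁴·(L³)⁻¹)ᵏ = Lᵏ` — the B-slot `B·Lᵏ·KD` of `hMcomb` with `B = 1` per direction pair.
[folklore] -/
theorem gradWeight_pow_d3 (L : ℕ) (hL : 1 ≤ L) (k : ℕ) :
    ((L : ℝ) ^ 4 * ((L : ℝ) ^ 3)⁻¹) ^ k = (L : ℝ) ^ k := by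
  have hL0 : (L : ℝ) ≠ 0 := by exact_mod_cast (show L ≠ 0 by omega)
  have h : (L : ℝ) ^ 4 * ((L : ℝ) ^ 3)⁻¹ = (L : ℝ) := by
    rw [show (L : ℝ) ^ 4 = (L : ℝ) * (L : ℝ) ^ 3 by ring, mul_assoc, mul_inv_cancel₀ (pow_ne_zero 3 hL0), mul_one]
  rw [h]

end Summit.QuantumFields.YangMills.Theorems.Prop7CornerCombFlatGradTransfer
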